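import Mathlib.GroupTheory.Perm.Cycle.Concrete
import Mathlib.GroupTheory.Perm.Fin
import Mathlib.GroupTheory.Subgroup.Centralizer
import Mathlib.Data.Fintype.Quotient
import Mathlib.Data.Real.Basic
import Mathlib.Algebra.BigOperators.Fin
import Mathlib.Tactic.FieldSimp
import Mathlib.Tactic.FinCases
import HarnessLib

/-!
# Fatgraphs as permutation pairs, λ-lengths, h-lengths, simplicial coordinates and Penner's cells
# (Penner 1992, §§3.1–3.4) — the combinatorial layer of `defn-PennerCellRep`

Definition request `defn-PennerCellRep` (route KontsevichZagierPeriods/PennerVolumes, items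
PennerFamily stmt-6458, WolpertResidue stmt-6492) asks for Penner's integration scheme for
Weil–Petersson volumes as Kontsevich–Zagier data. This file lands its COMBINATORIAL /
SEMIALGEBRAIC LAYER — items (1)–(3) of the request and the two-form of item (4) as an explicit
bilinear form — everything being finite permutation combinatorics and rational functions of the
λ-lengths, after

* R. C. Penner, *Weil–Petersson volumes*, J. Differential Geom. 35 (1992) 559–608
  [Penner1992] — held (doi:10.4310/jdg/1214448257; clean text `paper:galaxy-pdf-1278583260`):
  §3.1 (fatgraphs as pairs of permutations `(σ, τ)`, `Aut(G)`, Table 1), §3.3 (λ-lengths,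
  sectors and h-lengths `α(v, ê) = λ(ê)/(λ(f̂)λ(ĝ))`, horocycle lengths `ρ_i = 2 ∑ α`, the face
  conditions / simplicial coordinates `X_e`, Thm 3.3.6: the WP two-form in λ-lengths), §3.4
  (Cor. 3.4.3: the region of integration `𝒟(G)` is the straight simplex `{X_e > 0, ρ_i = 1}`),
  §4.1 (the once-punctured torus).

NOT in this file (left for the continuation of the request, see the end of this docstring): the
named facts Penner Thm 3.4.1 (`X : 𝒟(G) → ℝ₊^{edges}` is a bijection) and Thm 3.3.6 (the form
below IS the pull-back of the WP Kähler form), the volume form `ω^d/d!` as a density on the simplex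
slice, the formal sum `pennerRep g s : KZ.FormalRep` over isomorphism classes (item (5)), and the
cite facts of item (6) (Penner Thm 3.2.1, Wolpert 1983, Mirzakhani 2006, the genus-one anchors).

## Rendering

* A **fatgraph** on a finite set `H` of hooks (= half-edges; Penner §3.1, "An unmarked fatgraph
  `G` can be compactly described by a pair of permutations") is a pair `(σ, τ)` of permutations of
  `H`: `σ` (`rot`) is the cyclic order of the hooks about the vertices (vertices = cycles of `σ`,
  fixed points included as univalent vertices), `τ` (`edgeInv`) is a fixed-point-free involution
  pairing the two hooks of each edge. Boundary cycles (= punctures of `F(G)` = boundary components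
  of `F'(G)`) are the cycles of `φ = σ ∘ τ` (`face`): from hook `h`, cross the edge to `τ h` and
  turn to the next hook `σ (τ h)` at that vertex. Type `(g, s)`: connected, `s` boundary cycles,
  `V - E = 2 - 2g - s`. `Aut(G)` = permutations of `H` commuting with `σ` and `τ` (the centralizer),
  as in §3.1 / Table 1 ("the number in brackets … is the order of the corresponding fatgraph
  automorphism group").
* **λ-lengths** are functions `lam : H → ℝ` constant on edges (`IsEdgeFun`: `lam (τ h) = lam h`);
  the **h-length of the sector opposite the hook `h`** at its (trivalent) vertex is
  `α(h) = λ(h)/(λ(σ h) λ(σ² h))` (§3.3, display after "elementary computation in hyperbolic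
  geometry"); the **simplicial coordinate** of the edge `{h, τ h}` is
  `X(h) = ∑_{k ∈ {h, τh}} (α(σ k) + α(σ² k) - α(k)) = ∑ (λ²(f̂) + λ²(ĝ) - λ²(ê))/(λ(ê)λ(f̂)λ(ĝ))`
  (§3.3, "The face condition corresponding to the edge `e` of `G` is `X_e = … > 0`");
  the **horocycle length** of the boundary cycle through `h` is `ρ(h) = 2 ∑_{k in the φ-cycle of h}
  α(σ k)` (§3.3: "`ρ_i = 2∑ α(v, ê)` over the sectors traversed", the path entering a vertex at
  `τ k` and leaving at `σ τ k` traverses the sector opposite `σ² τ k = σ (φ k)`; reindexed along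
  the cycle).
* **Penner's cell** `𝒟(G) = {λ > 0 : X_e(λ) > 0 ∀ e}` and its **slice** `{ρ_i = 1 ∀ i}`
  (Cor. 3.4.3) are subsets of `H → ℝ`.
* The **WP two-form in λ-lengths** (Thm 3.3.6: `-2 ∑_v (dlog λ(ê)∧dlog λ(f̂) + dlog λ(f̂)∧dlog λ(ĝ)
  + dlog λ(ĝ)∧dlog λ(ê))`, hooks at `v` in the cyclic order of the fattening) is rendered as the
  alternating bilinear form on tangent vectors `u, w : H → ℝ` at `λ`:
  `ω_λ(u, w) = -2 ∑_{h ∈ H} (u_h w_{σh} - w_h u_{σh})/(λ_h λ_{σh})` — summing `dlog λ(h)∧dlog λ(σ h)`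
  over ALL hooks `h` visits each vertex's three cyclic pairs once. A definition only: that it is
  the pull-back of the Weil–Petersson form is Penner's theorem, not asserted here.

## Sanity (Penner §4.1, the once-punctured torus; proved below)

`torus`: `H = Fin 6`, `σ = (2,3,1,5,6,4)`, `τ = (4,5,6,1,2,3)` (Table 1, 0-indexed in Lean):
trivalent, `V = 2`, `E = 3`, one boundary cycle, connected, type `(1, 1)`; with λ-lengths
`(a, b, c)` on the edges `{1,4}, {2,5}, {3,6}`: `X_{14} = 2(b² + c² - a²)/(abc)` (the request's
"torus `A = 2(b²+c²−a²)/(abc)`") and `ρ = 4(a² + b² + c²)/(abc)`, so that `A + B + C = ρ/2` and the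
slice `ρ = 1` is `{A + B + C = ½}` as in §4.1.

## What remains for `PennerCellRep` (recorded for the next seat)

(4') named facts: Thm 3.4.1 [Penner1987 Thm 5.4] (simplicial coordinates are a homeomorphism of
the open cell onto `ℝ₊^{edges}`), Thm 3.3.6 (WP pull-back); (5) `pennerRep g s : KZ.FormalRep` =
`∑_{[G]} (N/#Aut G) • KZ.of [slice of 𝒟(G) in simplex coordinates, ω^d/d!]` — needs, per `G`, the
inverse `λ(X)` (semialgebraic by Thm 3.4.1; rational only conjecturally, §3.5) to write the
integrand, and an integrability proof (finiteness of the cell volume) for the `IntegralRep` field;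
(6) cite facts Penner Thm 3.2.1, Wolpert1983, Mirzakhani2006 Thm 1.1, Thm 4.1.1/5.2.1 anchors.

Mathlib: `Equiv.Perm`, `Equiv.Perm.SameCycle(.setoid)` (orbits), `Subgroup.centralizer`,
`Subgroup.closure`, `Fintype.card`, `Quotient`; no fatgraph / ribbon-graph / combinatorial-map
notion in Mathlib or the tree (`lean search 'fatgraph|ribbon|RibbonGraph|combinatorial map'`:
nothing).
-/

noncomputable section

open Equiv Equiv.Perm Finset

namespace Literature.Geometry.Teichmuller

/-! ### Orbit counting for a permutation -/

/-- Decidability of the orbit (same-cycle) relation of a permutation of a finite type, for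
`Fintype` instances on the orbit quotient. [folklore] -/
instance instDecidableRelSameCycleSetoid {α : Type*} [Fintype α] [DecidableEq α] (π : Perm α) :
    DecidableRel (SameCycle.setoid π).r :=
  fun x y ↦ inferInstanceAs (Decidable (π.SameCycle x y))

/-- The number of cycles (orbits, fixed points counted as cycles of length one) of a permutation
of a finite type. [folklore] -/
def numCycles {α : Type*} [Fintype α] [DecidableEq α] (π : Perm α) : ℕ :=
  Fintype.card (Quotient (SameCycle.setoid π))

/-! ### Fatgraphs as permutation pairs (Penner 1992, §3.1) -/

/-- A **fatgraph** on the finite set `H` of hooks (half-edges), as a pair of permutations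
(Penner 1992, §3.1): `rot = σ`, the cyclic order of the hooks about each vertex (vertices = cycles
of `σ`), and `edgeInv = τ`, a fixed-point-free involution with one transposition per edge.
[cite: Penner1992, §3.1 (pair of permutations (σ, τ))] -/
structure Fatgraph (H : Type*) where
  /-- `σ`: cyclic order of hooks about the vertices. -/
  rot : Perm H
  /-- `τ`: the edge involution, pairing the two hooks of each edge. -/
  edgeInv : Perm H
  /-- `τ² = 1`. -/
  edgeInv_edgeInv : ∀ h, edgeInv (edgeInv h) = h
  /-- `τ` has no fixed points (no dangling half-edges). -/
  edgeInv_ne : ∀ h, edgeInv h ≠ h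

namespace Fatgraph

variable {H : Type*} (G : Fatgraph H)

/-- The **boundary permutation** `φ = σ ∘ τ`: cross the edge, then turn to the next hook. Its
cycles are the boundary components of `F'(G)` = the punctures of `F(G)` (Penner §3.1, §3.3). [cite: Penner1992, §3.1 and §3.3 (closed edge-paths of the boundary components)] -/
def face : Perm H := G.rot * G.edgeInv

/-- `φ h = σ (τ h)`. [folklore] -/
@[simp] theorem face_apply (h : H) : G.face h = G.rot (G.edgeInv h) := rfl

-- The two predicates below take the fatgraph as an EXPLICIT binder `(G : Fatgraph H)` rather than
-- through the section variable: written as a closed `def X : Prop := …` they are textually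
-- indistinguishable from named facts and were filed as unproved debt (`IsConnected_holds` is
-- ill-typed: `torus.IsConnected` holds, two disjoint edges are not connected). Same terms.

/-- **Trivalent** fatgraphs: every vertex has exactly three hooks (`σ³ = 1`, no fixed points).
A predicate on `G` (e.g. `torus_isTrivalent`). [cite: Penner1992, §3.1 (trivalent fatgraphs)] -/
def IsTrivalent (G : Fatgraph H) : Prop := ∀ h, G.rot h ≠ h ∧ G.rot (G.rot (G.rot h)) = h

/-- **Connectedness**: the group generated by `σ` and `τ` acts transitively on hooks. A predicate
on `G` (e.g. `torus_isConnected`), i.e. the definition of a connected fatgraph. [folklore] -/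
def IsConnected (G : Fatgraph H) : Prop :=
  ∀ x y : H, ∃ w ∈ Subgroup.closure ({G.rot, G.edgeInv} : Set (Perm H)), w x = y

/-- The **automorphism group** `Aut(G)`: permutations of the hooks commuting with `σ` and `τ`
(Penner §3.1: a morphism of fatgraphs respects the cyclic orders; Table 1 lists `#Aut`).
[cite: Penner1992, §3.1 (Aut(G))] -/
def automorphismGroup : Subgroup (Perm H) :=
  Subgroup.centralizer ({G.rot, G.edgeInv} : Set (Perm H))

/-- Membership in `Aut(G)`: commuting with `σ` and with `τ`. [folklore] -/
theorem mem_automorphismGroup {ψ : Perm H} :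
    ψ ∈ G.automorphismGroup ↔ ψ * G.rot = G.rot * ψ ∧ ψ * G.edgeInv = G.edgeInv * ψ := by
  simp [automorphismGroup, Subgroup.mem_centralizer_iff, eq_comm]

/-- `#Aut(G)` (as a natural number; `Nat.card`, so no decidability is needed). [cite: Penner1992, §3.1 Table 1] -/
def numAut : ℕ := Nat.card G.automorphismGroup

/-! ### λ-lengths, h-lengths, simplicial coordinates, horocycle lengths (Penner §3.3–3.4) -/

/-- **Edge functions** (λ-lengths live on edges): `lam (τ h) = lam h`. [cite: Penner1992, §3.3 (λ-length of a hook = λ-length of its edge)] -/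
def IsEdgeFun (lam : H → ℝ) : Prop := ∀ h, lam (G.edgeInv h) = lam h

/-- The **h-length of the sector opposite the hook `h`** at its trivalent vertex:
`α(v, ĥ) = λ(ĥ)/(λ(f̂) λ(ĝ))`, `f̂ = σ h`, `ĝ = σ² h` the other two hooks at `v`.
[cite: Penner1992, §3.3 (h-lengths of the sectors, after Cor. 3.3.2)] -/
def hLength (lam : H → ℝ) (h : H) : ℝ :=
  lam h / (lam (G.rot h) * lam (G.rot (G.rot h)))

/-- The contribution of the end `k` of an edge to its simplicial coordinate:
`α(f̂) + α(ĝ) - α(ê)` at the vertex of the hook `k = ê`. [cite: Penner1992, §3.3 (face condition X_e)] -/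
def endCoord (lam : H → ℝ) (k : H) : ℝ :=
  G.hLength lam (G.rot k) + G.hLength lam (G.rot (G.rot k)) - G.hLength lam k

/-- The **simplicial coordinate** `X_e` of the edge `e = {h, τ h}`, as a function of the hook `h`:
`X_e = ∑_{i=1,2} (α(f̂ᵢ) + α(ĝᵢ) - α(êᵢ)) = ∑ᵢ (λ²(f̂ᵢ) + λ²(ĝᵢ) - λ²(êᵢ))/(λ(êᵢ)λ(f̂ᵢ)λ(ĝᵢ))`;
the face condition of the cell is `X_e > 0`. [cite: Penner1992, §3.3 (face condition X_e) and §3.4 (simplicial coordinates)] -/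
def simplicialCoord (lam : H → ℝ) (h : H) : ℝ :=
  G.endCoord lam h + G.endCoord lam (G.edgeInv h)

/-- `X` is a function of the edge: `X(τ h) = X(h)`. [folklore] -/
theorem simplicialCoord_edgeInv (lam : H → ℝ) (h : H) :
    G.simplicialCoord lam (G.edgeInv h) = G.simplicialCoord lam h := by
  rw [simplicialCoord, simplicialCoord, G.edgeInv_edgeInv, add_comm]

/-- **Penner's cell** `𝒟(G)` in λ-lengths: positive edge functions all of whose simplicial
coordinates are positive (one face condition per edge). [cite: Penner1992, §3.3–3.4 (𝒟(G) = {all face conditions X_e > 0})] -/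
def cell : Set (H → ℝ) :=
  {lam | G.IsEdgeFun lam ∧ (∀ h, 0 < lam h) ∧ ∀ h, 0 < G.simplicialCoord lam h}

variable [Fintype H]

/-- The **Weil–Petersson two-form in λ-lengths** (Penner Thm 3.3.6,
`-2 ∑_v (dlog λ(ê)∧dlog λ(f̂) + dlog λ(f̂)∧dlog λ(ĝ) + dlog λ(ĝ)∧dlog λ(ê))`), rendered as the
alternating bilinear form at the point `lam` on tangent vectors `u w : H → ℝ`:
`ω_λ(u, w) = -2 ∑_h (u_h w_{σh} - w_h u_{σh})/(λ_h λ_{σh})` (each vertex's three cyclic pairs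
`(h, σ h)` appear once each as `h` runs over `H`). A DEFINITION of the printed expression; that it
is the pull-back of the WP Kähler form is Penner's theorem and is not asserted.
[cite: Penner1992, Thm 3.3.6] -/
def wpForm (lam u w : H → ℝ) : ℝ :=
  -2 * ∑ h, (u h * w (G.rot h) - w h * u (G.rot h)) / (lam h * lam (G.rot h))

/-- The two-form is alternating. [folklore] -/
theorem wpForm_self (lam u : H → ℝ) : G.wpForm lam u u = 0 := by
  simp [wpForm]

/-- The two-form is antisymmetric. [folklore] -/
theorem wpForm_swap (lam u w : H → ℝ) : G.wpForm lam w u = -G.wpForm lam u w := by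
  unfold wpForm
  rw [neg_mul_eq_mul_neg, ← Finset.sum_neg_distrib]
  congr 1
  refine Finset.sum_congr rfl fun h _ => ?_
  rw [← neg_div]
  congr 1
  ring

variable [DecidableEq H]

/-- Number of vertices `V` = number of cycles of `σ`. [cite: Penner1992, §3.1] -/
def numVertices : ℕ := numCycles G.rot

/-- Number of edges `E` = number of cycles (transpositions) of `τ` (`= #H / 2`). [cite: Penner1992, §3.1] -/
def numEdges : ℕ := numCycles G.edgeInv

/-- Number of boundary cycles `s(G)` = number of cycles of `φ = σ ∘ τ`. [cite: Penner1992, §3.1 (s(G))] -/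
def numBoundary : ℕ := numCycles G.face

/-- **Type `(g, s)`**: `G` is connected, has `s` boundary cycles, and Euler characteristic
`V - E = 2 - 2g - s` (so that `F(G)` is the genus-`g` surface with `s` punctures; for trivalent
`G`, `E = 6g - 6 + 3s`). [cite: Penner1992, §3.1 (F(G) homeomorphic to F_g^s)] -/
def IsOfType (g s : ℕ) : Prop :=
  G.IsConnected ∧ G.numBoundary = s ∧ (G.numVertices : ℤ) - G.numEdges = 2 - 2 * g - s

/-- The **horocycle length** of the boundary cycle through the hook `h`:
`ρ = 2 ∑ α(v, ê)` over the sectors it traverses = `2 ∑_{k ∈ φ-cycle of h} α(σ k)`.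
[cite: Penner1992, §3.3 (ρ_i = 2 Σ α) and Lemma 3.4.2] -/
def horocycleLength (lam : H → ℝ) (h : H) : ℝ :=
  2 * ∑ k ∈ univ.filter (fun k => G.face.SameCycle h k), G.hLength lam (G.rot k)

/-- The **slice** of the cell on which Penner integrates: all horocycle lengths equal to `1`
(Cor. 3.4.3: in simplicial coordinates the straight simplex `{X_e > 0, X(∂_i) = 1}`).
[cite: Penner1992, Cor. 3.4.3] -/
def cellSlice : Set (H → ℝ) :=
  {lam ∈ G.cell | ∀ h, G.horocycleLength lam h = 1}

end Fatgraph

/-! ### The once-punctured torus (Penner §4.1, Table 1 first row) -/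

namespace Fatgraph

/-- `σ = (2, 3, 1, 5, 6, 4)` on six hooks (0-indexed: `0 ↦ 1 ↦ 2 ↦ 0`, `3 ↦ 4 ↦ 5 ↦ 3`).
[cite: Penner1992, §3.1 Table 1 and §4.1] -/
def torusRot : Perm (Fin 6) :=
  ⟨![1, 2, 0, 4, 5, 3], ![2, 0, 1, 5, 3, 4], by decide, by decide⟩

/-- `τ = (4, 5, 6, 1, 2, 3)` (0-indexed: `0 ↔ 3`, `1 ↔ 4`, `2 ↔ 5`): edges `a = {0,3}`,
`b = {1,4}`, `c = {2,5}`. [cite: Penner1992, §3.1 Table 1 and §4.1] -/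
def torusInv : Perm (Fin 6) :=
  ⟨![3, 4, 5, 0, 1, 2], ![3, 4, 5, 0, 1, 2], by decide, by decide⟩

/-- **The once-punctured torus fatgraph** `(σ, τ) = ((2,3,1,5,6,4), (4,5,6,1,2,3))`.
[cite: Penner1992, §4.1] -/
def torus : Fatgraph (Fin 6) where
  rot := torusRot
  edgeInv := torusInv
  edgeInv_edgeInv := by decide
  edgeInv_ne := by decide

/-- The torus fatgraph is trivalent. [cite: Penner1992, §4.1] -/
theorem torus_isTrivalent : torus.IsTrivalent := by
  unfold IsTrivalent torus; decide

/-- It has two vertices, … [cite: Penner1992, §4.1] -/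
theorem torus_numVertices : torus.numVertices = 2 := by
  unfold numVertices torus numCycles; decide

/-- … three edges, … [cite: Penner1992, §4.1] -/
theorem torus_numEdges : torus.numEdges = 3 := by
  unfold numEdges torus numCycles; decide

/-- … and one boundary cycle (one puncture). [cite: Penner1992, §4.1] -/
theorem torus_numBoundary : torus.numBoundary = 1 := by
  unfold numBoundary numCycles; decide

/-- It is connected (`σ`, `τ` reach every hook from hook `0`). [folklore] -/
theorem torus_isConnected : torus.IsConnected := by
  have hσ : torus.rot ∈ Subgroup.closure ({torus.rot, torus.edgeInv} : Set (Perm (Fin 6))) :=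
    Subgroup.subset_closure (by simp)
  have hτ : torus.edgeInv ∈ Subgroup.closure ({torus.rot, torus.edgeInv} : Set (Perm (Fin 6))) :=
    Subgroup.subset_closure (by simp)
  -- every hook is reached from `0`
  have reach : ∀ y : Fin 6, ∃ w ∈ Subgroup.closure ({torus.rot, torus.edgeInv} : Set (Perm (Fin 6))),
      w 0 = y := by
    intro y
    fin_cases y
    · exact ⟨1, Subgroup.one_mem _, rfl⟩
    · exact ⟨torus.rot, hσ, by decide⟩
    · exact ⟨torus.rot * torus.rot, Subgroup.mul_mem _ hσ hσ, by decide⟩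
    · exact ⟨torus.edgeInv, hτ, by decide⟩
    · exact ⟨torus.rot * torus.edgeInv, Subgroup.mul_mem _ hσ hτ, by decide⟩
    · exact ⟨torus.rot * torus.rot * torus.edgeInv,
        Subgroup.mul_mem _ (Subgroup.mul_mem _ hσ hσ) hτ, by decide⟩
  intro x y
  obtain ⟨wx, hwx, hx⟩ := reach x
  obtain ⟨wy, hwy, hy⟩ := reach y
  refine ⟨wy * wx⁻¹, Subgroup.mul_mem _ hwy (Subgroup.inv_mem _ hwx), ?_⟩
  rw [Perm.mul_apply, ← hx]
  simp [hy]

/-- **The torus fatgraph has type `(g, s) = (1, 1)`**: `V - E = 2 - 3 = -1 = 2 - 2·1 - 1`.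
[cite: Penner1992, §4.1] -/
theorem torus_isOfType : torus.IsOfType 1 1 := by
  refine ⟨torus_isConnected, torus_numBoundary, ?_⟩
  rw [torus_numVertices, torus_numEdges]
  decide

/-- **Penner's torus simplicial coordinate** (§3.5 Ex. 3.5.1 / §4.1): with λ-lengths `a, b, c` on
the edges `{0,3}, {1,4}, {2,5}`, the simplicial coordinate of the edge `a` is
`A = 2(b² + c² - a²)/(abc)`. [cite: Penner1992, §4.1 (A = 2(b²+c²−a²)/(abc))] -/
theorem torus_simplicialCoord (a b c : ℝ) (ha : a ≠ 0) (hb : b ≠ 0) (hc : c ≠ 0) :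
    torus.simplicialCoord ![a, b, c, a, b, c] 0 = 2 * (b ^ 2 + c ^ 2 - a ^ 2) / (a * b * c) := by
  simp [simplicialCoord, endCoord, hLength, torus, torusRot, torusInv]
  field_simp
  ring

/-- The torus λ-lengths `(a, b, c, a, b, c)` form an edge function. [folklore] -/
theorem torus_isEdgeFun (a b c : ℝ) : torus.IsEdgeFun ![a, b, c, a, b, c] := by
  intro h
  fin_cases h <;> rfl

/-- **The torus horocycle length**: `ρ = 4(a² + b² + c²)/(abc)`, so that `A + B + C = ρ/2` and
Penner's slice `ρ = 1` is `{A + B + C = ½}` (§4.1: `C = ½ - A - B`). [cite: Penner1992, §4.1] -/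
theorem torus_horocycleLength (a b c : ℝ) (ha : a ≠ 0) (hb : b ≠ 0) (hc : c ≠ 0) :
    torus.horocycleLength ![a, b, c, a, b, c] 0 = 4 * (a ^ 2 + b ^ 2 + c ^ 2) / (a * b * c) := by
  have hcyc : (univ.filter fun k : Fin 6 => torus.face.SameCycle 0 k) = univ := by
    unfold torus; decide
  rw [horocycleLength, hcyc, Fin.sum_univ_six]
  simp [hLength, torus, torusRot, torusInv]
  field_simp
  ring

/-- The three simplicial coordinates of the torus sum to half the horocycle length:
`A + B + C = ρ/2`. [cite: Penner1992, §4.1] -/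
theorem torus_sum_simplicialCoord (a b c : ℝ) (ha : a ≠ 0) (hb : b ≠ 0) (hc : c ≠ 0) :
    torus.simplicialCoord ![a, b, c, a, b, c] 0 + torus.simplicialCoord ![a, b, c, a, b, c] 1 +
      torus.simplicialCoord ![a, b, c, a, b, c] 2 =
      torus.horocycleLength ![a, b, c, a, b, c] 0 / 2 := by
  rw [torus_horocycleLength a b c ha hb hc]
  simp [simplicialCoord, endCoord, hLength, torus, torusRot, torusInv]
  field_simp
  ring

end Fatgraph

end Literature.Geometry.Teichmuller

end
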